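import Summits.AtomisticToContinuum.HydrodynamicLimit.Theses.VitaliAmplitudeTransfer
import Summits.AtomisticToContinuum.HydrodynamicLimit.Theorems.ImplosionDichotomyPolynomialCompressionEosRatioAnalytic
import Summits.AtomisticToContinuum.HydrodynamicLimit.Theorems.OneFlightGossipEngineUniformLocalGibbsConcentration
import Summits.AtomisticToContinuum.HydrodynamicLimit.Theorems.PolynomialCompression.Negative.Statics

/-!
# `VitaliAmplitudeTransfer.LocalGibbsStatics` PROVED — low-density statics of the canonical local Gibbs laws

Support item stmt-AtomisticToContinuum-11874 (`LocalGibbsStatics`, route `VitaliAmplitudeTransfer` of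
`AtomisticToContinuum/HydrodynamicLimit`). For bounds `B ≥ 1` there is `σ₀(B) > 0` such that for every
reduced diameter `0 < σ < σ₀` the LOCAL EQUATION OF STATE of the hard-sphere gas and its inverse,
```
  R z    = z · Φ(σ³ z)      (density as a function of the activity),
  Rinv y = y · Rf(σ³ y)     (activity as a function of the density),
```
are real-analytic on `[0, 4B²]`, `R` is strictly increasing with `R 0 = 0`, `z/2 ≤ R z ≤ 2z` and
`Rinv (R z) = z` on `[0, 4B²]`, `R (Rinv y) = y` and `y/2 ≤ Rinv y ≤ 2y` on `[0, 2B]`; and for continuous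
profiles `(a, θ₀, u₀)` within `[B⁻¹, B]` the chemical potential `μ = log (ratioLimit / ∫a)` normalises
`∫ R(e^μ a) = 1`, keeps `e^μ a ∈ [0, 4B²]`, the local Gibbs laws are probability measures and their three
empirical fields at time `0` converge in probability to `(R(e^μ a), u₀, θ₀)` through every flow family.

Here `Φ(u) = Σ_j bE j uʲ/j!` is the insertion series of the cluster constants of `HardSphereCanonicalTorus`
(`EosRatioAnalytic.eosPhi_spec`) and `Rf` the analytic insertion factor of the landed
`stub_eosRatioAnalytic` (`Rf x · Φ(x Rf x) = 1`, `1 ≤ Rf ≤ 2`, unique root in `[1/2, 2]`), both read on a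
common small ball `(-ρ₀, ρ₀)` on which `Φ ∈ (1/2, 3/2)` and `u ↦ u Φ(u)` is strictly increasing
(`eos_package`); the smallness `σ³ · 8B² < ρ₀` puts every argument inside that ball (`eos_clauses`: the
two inversion identities are the functional equation and the uniqueness of the root). The profile part
(`statics_of_bounds`) is the tree's cluster expansion: with `P = profileOf a` one has `P.M ≤ B²`
(`profileOf_β_le`), so `e · 2 P.M v₁ σ³ ≤ 1/32` is a condition on `B` only, giving `SmallDensity P σ`
(`UniformLGC.smallDensity_of_eta_le`), `e^μ a = ratioLimit · β`, `R(e^μ a) = rhoLim P σ`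
(`rhoLim_eq_mul_phi`), unit mass (`PolynomialCompressionStatics.integral_rhoLim_eq_one`) and the
identified law of large numbers from the landed exponential field bounds of `UniformLGC`
(`localGibbsMeasure_density_le / …momentum_le / …energy_le`) through `localGibbsLaw_preimage_flow_zero`.

Sources: Ruelle 1969 Thm 4.2.3 / Lebowitz–Penrose 1964 (analytic low-density equation of state),
Pulvirenti–Tsagkarogiannis 2012 (canonical cluster expansion), Spohn 1991 Part I §2.3 (local equilibrium).
No definitions (pure-proof file). prover-pitem-stmt-AtomisticToContinuum-11874-0.
-/

noncomputable section

namespace Summit.AtomisticToContinuum.HydrodynamicLimit.Theorems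

open MeasureTheory Filter Set Topology
open scoped ENNReal
open Literature.MathematicalPhysics.KineticTheory Literature.Analysis.FluidPDE

namespace VitaliLocalGibbsStatics

/-! ### §1 The insertion series and the insertion factor on a common small ball -/

/-- **The equation-of-state package.** There are `ρ₀ > 0`, the insertion series
`Φ u = Σ_j bE j uʲ/j!` and the insertion factor `Rf` with: on `|u| < ρ₀`, `Φ` analytic with
`1/2 < Φ u < 3/2` and `u ↦ u Φ(u)` strictly increasing; on `|x| < ρ₀`, `Rf` analytic, positive,
`Rf x · Φ(x Rf x) = 1`, `1 ≤ Rf x ≤ 2` for `x ≥ 0`, and `Rf x` the only root of `R Φ(xR) = 1` in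
`[1/2, 2]` (`EosRatioAnalytic.eosPhi_spec`, `stub_eosRatioAnalytic`, continuity at `0`). -/
theorem eos_package :
    ∃ ρ₀ : ℝ, 0 < ρ₀ ∧ ∃ Φ Rf : ℝ → ℝ,
      (∀ u, Φ u = ∑' j : ℕ, bE j / (j.factorial : ℝ) * u ^ j) ∧
      (∀ u : ℝ, |u| < ρ₀ → AnalyticAt ℝ Φ u ∧ 1 / 2 < Φ u ∧ Φ u < 3 / 2) ∧
      StrictMonoOn (fun u => u * Φ u) (Ioo (-ρ₀) ρ₀) ∧
      (∀ x : ℝ, |x| < ρ₀ → AnalyticAt ℝ Rf x) ∧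
      (∀ x ∈ Ioo (-ρ₀) ρ₀, 0 < Rf x ∧ Rf x * Φ (x * Rf x) = 1) ∧
      (∀ x ∈ Icc 0 ρ₀, 1 ≤ Rf x ∧ Rf x ≤ 2) ∧
      (∀ x ∈ Ioo (-ρ₀) ρ₀, ∀ R ∈ Icc (1 / 2 : ℝ) 2, R * Φ (x * R) = 1 → R = Rf x) := by
  obtain ⟨Φ, hΦeq, hΦa, hΦ0, -⟩ := EosRatioAnalytic.eosPhi_spec
  obtain ⟨r, hr, Rf, ⟨p, hp⟩, -, -, hsol, hbd, -, huniq⟩ := stub_eosRatioAnalytic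
  -- `ψ(u) = u Φ(u)`: analytic at `0` with `ψ'(0) = 1`
  have hψa : AnalyticAt ℝ (fun u => u * Φ u) 0 := analyticAt_id.mul hΦa
  have hψd : deriv (fun u => u * Φ u) 0 = 1 := by
    have h := (hasDerivAt_id (0 : ℝ)).mul hΦa.differentiableAt.hasDerivAt
    have h' : HasDerivAt (fun u => u * Φ u) 1 0 := h.congr_deriv (by simp [hΦ0])
    exact h'.deriv
  have hev_an : ∀ᶠ u in 𝓝 (0 : ℝ), AnalyticAt ℝ Φ u := hΦa.eventually_analyticAt
  have hev_val : ∀ᶠ u in 𝓝 (0 : ℝ), Φ u ∈ Ioo (1 / 2 : ℝ) (3 / 2) :=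
    hΦa.continuousAt.eventually (Ioo_mem_nhds (by rw [hΦ0]; norm_num) (by rw [hΦ0]; norm_num))
  have hev_ψan : ∀ᶠ u in 𝓝 (0 : ℝ), AnalyticAt ℝ (fun u => u * Φ u) u := hψa.eventually_analyticAt
  have hev_der : ∀ᶠ u in 𝓝 (0 : ℝ), 0 < deriv (fun u => u * Φ u) u :=
    hψa.deriv.continuousAt.eventually (lt_mem_nhds (by rw [hψd]; norm_num))
  obtain ⟨δ, hδ, hδP⟩ :=
    Metric.eventually_nhds_iff.1 (hev_an.and (hev_val.and (hev_ψan.and hev_der)))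
  have hball : ∀ u : ℝ, |u| < δ → AnalyticAt ℝ Φ u ∧ Φ u ∈ Ioo (1 / 2 : ℝ) (3 / 2) ∧
      AnalyticAt ℝ (fun u => u * Φ u) u ∧ 0 < deriv (fun u => u * Φ u) u :=
    fun u hu => hδP (by rwa [Real.dist_eq, sub_zero])
  have hδr₁ : min δ r ≤ δ := min_le_left _ _
  have hδr₂ : min δ r ≤ r := min_le_right _ _
  have hIoo : ∀ x ∈ Ioo (-min δ r) (min δ r), x ∈ Ioo (-r) r := fun x hx =>
    ⟨by linarith [hx.1], hx.2.trans_le hδr₂⟩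
  refine ⟨min δ r, lt_min hδ hr, Φ, Rf, hΦeq, fun u hu => ?_, ?_, fun x hx => ?_, fun x hx => ?_,
    fun x hx => hbd x ⟨hx.1, hx.2.trans hδr₂⟩, fun x hx R hR h => ?_⟩
  · have h := hball u (hu.trans_le hδr₁)
    exact ⟨h.1, h.2.1.1, h.2.1.2⟩
  · refine strictMonoOn_of_deriv_pos (convex_Ioo _ _) (fun u hu => ?_) (fun u hu => ?_)
    · have h := hball u ((abs_lt.2 hu).trans_le hδr₁)
      exact h.2.2.1.differentiableAt.continuousAt.continuousWithinAt
    · rw [interior_Ioo] at hu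
      exact (hball u ((abs_lt.2 hu).trans_le hδr₁)).2.2.2
  · refine hp.analyticAt_of_mem ?_
    rw [Metric.mem_eball, edist_dist, Real.dist_eq, sub_zero]
    exact (ENNReal.ofReal_lt_ofReal_iff hr).2 (hx.trans_le hδr₂)
  · have h := hsol x (hIoo x hx)
    rw [← hΦeq] at h
    exact h
  · refine huniq x (hIoo x hx) R hR ?_
    rw [← hΦeq]
    exact h

/-! ### §2 The local equation of state `R z = z Φ(σ³ z)` and its inverse `Rinv y = y Rf(σ³ y)` -/

section EOS

variable {ρ₀ σ B : ℝ} {Φ Rf : ℝ → ℝ}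

/-- **The six equation-of-state clauses of `LocalGibbsStatics`** for `R z = z Φ(σ³ z)`,
`Rinv y = y Rf(σ³ y)` once `σ³ · 8B² < ρ₀`: analyticity of both on `[0, 4B²]`, strict monotonicity
of `R`, `R 0 = 0`, `Rinv ∘ R = id` with `z/2 ≤ R z ≤ 2z` on `[0, 4B²]` (uniqueness of the root: both
`Rf(uΦ(u))` and `Φ(u)⁻¹` solve `t Φ(uΦ(u) t) = 1`), and `R ∘ Rinv = id` with `y/2 ≤ Rinv y ≤ 2y` on
`[0, 2B]` (the functional equation `Rf x Φ(x Rf x) = 1`). -/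
theorem eos_clauses (hB : 1 ≤ B) (hσ : 0 < σ) (hpack : σ ^ 3 * (8 * B ^ 2) < ρ₀)
    (hΦan : ∀ u : ℝ, |u| < ρ₀ → AnalyticAt ℝ Φ u ∧ 1 / 2 < Φ u ∧ Φ u < 3 / 2)
    (hψ : StrictMonoOn (fun u => u * Φ u) (Ioo (-ρ₀) ρ₀))
    (hRfan : ∀ x : ℝ, |x| < ρ₀ → AnalyticAt ℝ Rf x)
    (hsol : ∀ x ∈ Ioo (-ρ₀) ρ₀, 0 < Rf x ∧ Rf x * Φ (x * Rf x) = 1)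
    (hbd : ∀ x ∈ Icc 0 ρ₀, 1 ≤ Rf x ∧ Rf x ≤ 2)
    (huniq : ∀ x ∈ Ioo (-ρ₀) ρ₀, ∀ R ∈ Icc (1 / 2 : ℝ) 2, R * Φ (x * R) = 1 → R = Rf x) :
    AnalyticOnNhd ℝ (fun z => z * Φ (σ ^ 3 * z)) (Icc 0 (4 * B ^ 2)) ∧
    AnalyticOnNhd ℝ (fun y => y * Rf (σ ^ 3 * y)) (Icc 0 (4 * B ^ 2)) ∧
    StrictMonoOn (fun z => z * Φ (σ ^ 3 * z)) (Icc 0 (4 * B ^ 2)) ∧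
    (0 : ℝ) * Φ (σ ^ 3 * 0) = 0 ∧
    (∀ z ∈ Icc (0 : ℝ) (4 * B ^ 2),
      z * Φ (σ ^ 3 * z) * Rf (σ ^ 3 * (z * Φ (σ ^ 3 * z))) = z ∧
        z / 2 ≤ z * Φ (σ ^ 3 * z) ∧ z * Φ (σ ^ 3 * z) ≤ 2 * z) ∧
    (∀ y ∈ Icc (0 : ℝ) (2 * B),
      y * Rf (σ ^ 3 * y) * Φ (σ ^ 3 * (y * Rf (σ ^ 3 * y))) = y ∧
        y / 2 ≤ y * Rf (σ ^ 3 * y) ∧ y * Rf (σ ^ 3 * y) ≤ 2 * y) := by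
  have hσ3 : 0 < σ ^ 3 := pow_pos hσ 3
  have hB2 : 1 ≤ B ^ 2 := one_le_pow₀ hB
  have hρ₀ : 0 < ρ₀ := lt_of_le_of_lt (by positivity) hpack
  -- every argument `σ³ z`, `0 ≤ z ≤ 4B²`, lies in `[0, ρ₀/2)`
  have harg : ∀ z ∈ Icc (0 : ℝ) (4 * B ^ 2), 0 ≤ σ ^ 3 * z ∧ σ ^ 3 * z < ρ₀ / 2 := by
    intro z hz
    refine ⟨mul_nonneg hσ3.le hz.1, ?_⟩
    calc σ ^ 3 * z ≤ σ ^ 3 * (4 * B ^ 2) := mul_le_mul_of_nonneg_left hz.2 hσ3.le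
      _ = σ ^ 3 * (8 * B ^ 2) / 2 := by ring
      _ < ρ₀ / 2 := by linarith
  have habs : ∀ z ∈ Icc (0 : ℝ) (4 * B ^ 2), |σ ^ 3 * z| < ρ₀ := fun z hz => by
    rw [abs_of_nonneg (harg z hz).1]
    linarith [(harg z hz).2]
  refine ⟨fun z hz => ?_, fun y hy => ?_, ?_, by rw [zero_mul], fun z hz => ?_, fun y hy => ?_⟩
  · -- analyticity of `R`
    exact analyticAt_id.mul ((hΦan _ (habs z hz)).1.comp (analyticAt_const.mul analyticAt_id))
  · -- analyticity of `Rinv`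
    exact analyticAt_id.mul ((hRfan _ (habs y hy)).comp (analyticAt_const.mul analyticAt_id))
  · -- strict monotonicity of `R`
    intro z₁ hz₁ z₂ hz₂ hlt
    have h₁ : σ ^ 3 * z₁ ∈ Ioo (-ρ₀) ρ₀ := (abs_lt.1 (habs z₁ hz₁))
    have h₂ : σ ^ 3 * z₂ ∈ Ioo (-ρ₀) ρ₀ := (abs_lt.1 (habs z₂ hz₂))
    have h := hψ h₁ h₂ (mul_lt_mul_of_pos_left hlt hσ3)
    dsimp only at h
    rw [mul_assoc, mul_assoc] at h
    exact lt_of_mul_lt_mul_left h hσ3.le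
  · -- `Rinv (R z) = z` and the sandwich
    obtain ⟨hu0, hu⟩ := harg z hz
    obtain ⟨-, hΦ1, hΦ2⟩ := hΦan _ (habs z hz)
    set u := σ ^ 3 * z with hu_def
    have hΦpos : 0 < Φ u := by linarith
    -- the point `x = σ³ R z = u Φ(u)`
    have hx : σ ^ 3 * (z * Φ u) = u * Φ u := by rw [hu_def]; ring
    have hxmem : u * Φ u ∈ Ioo (-ρ₀) ρ₀ := by
      refine ⟨by nlinarith, ?_⟩
      calc u * Φ u ≤ (ρ₀ / 2) * (3 / 2) := mul_le_mul hu.le hΦ2.le hΦpos.le (by linarith)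
        _ < ρ₀ := by linarith
    have hroot : (Φ u)⁻¹ = Rf (u * Φ u) := by
      refine huniq _ hxmem _ ⟨?_, ?_⟩ ?_
      · rw [le_inv_comm₀ (by norm_num) hΦpos]; linarith
      · rw [inv_le_comm₀ hΦpos (by norm_num)]; linarith
      · rw [mul_assoc, mul_inv_cancel₀ hΦpos.ne', mul_one, inv_mul_cancel₀ hΦpos.ne']
    refine ⟨?_, by nlinarith [hz.1], by nlinarith [hz.1]⟩
    rw [hx, ← hroot, mul_assoc, mul_inv_cancel₀ hΦpos.ne', mul_one]
  · -- `R (Rinv y) = y` and the sandwich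
    have hy4 : y ∈ Icc (0 : ℝ) (4 * B ^ 2) := ⟨hy.1, hy.2.trans (by nlinarith)⟩
    obtain ⟨hx0, hx⟩ := harg y hy4
    have hxIoo : σ ^ 3 * y ∈ Ioo (-ρ₀) ρ₀ := abs_lt.1 (habs y hy4)
    obtain ⟨hR1, hR2⟩ := hbd (σ ^ 3 * y) ⟨hx0, by linarith⟩
    obtain ⟨-, hfe⟩ := hsol _ hxIoo
    refine ⟨?_, by nlinarith [hy.1], by nlinarith [hy.1]⟩
    calc y * Rf (σ ^ 3 * y) * Φ (σ ^ 3 * (y * Rf (σ ^ 3 * y)))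
        = y * (Rf (σ ^ 3 * y) * Φ (σ ^ 3 * y * Rf (σ ^ 3 * y))) := by ring_nf
      _ = y := by rw [hfe, mul_one]

end EOS

/-! ### §3 The profile part: normalisation and the identified law of large numbers -/

section Profiles

variable {B σ : ℝ} {a θ₀ : T3 → ℝ} {u₀ : T3 → V3}

/-- For an activity within `[B⁻¹, B]` the normalised profile `β = a/∫a` is at most `B²` (as is its
supremum `M`): `∫a ≥ B⁻¹` on the unit-volume torus. -/
theorem profileOf_β_le (hB : 1 ≤ B) (ha : Continuous a) (ha0 : ∀ x, 0 < a x)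
    (hbd : ∀ x, B⁻¹ ≤ a x ∧ a x ≤ B) :
    (∀ x, (profileOf a ha ha0).β x ≤ B ^ 2) ∧ (profileOf a ha ha0).M ≤ B ^ 2 := by
  have hB0 : 0 < B := by linarith
  have hint : B⁻¹ ≤ ∫ y, a y := by
    calc B⁻¹ = ∫ _ : T3, B⁻¹ := by simp
      _ ≤ ∫ y, a y := integral_mono (integrable_const _) (integrable_of_continuous_T3 ha) fun x => (hbd x).1
  have hβ : ∀ x, (profileOf a ha ha0).β x ≤ B ^ 2 := fun x => by
    rw [profileOf_β]
    calc a x / ∫ y, a y ≤ B / B⁻¹ := div_le_div₀ hB0.le (hbd x).2 (inv_pos.2 hB0) hint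
      _ = B ^ 2 := by rw [div_inv_eq_mul, sq]
  exact ⟨hβ, csSup_le (range_nonempty _) (by rintro _ ⟨x, rfl⟩; exact hβ x)⟩

/-- The cluster series through the insertion series: `rhoLim P σ x = R β(x) Φ(σ³ R β(x))`,
`R = ratioLimit P σ` (termwise: `γ_j R^{j+1} β^{j+1} = Rβ · bE j (σ³Rβ)ʲ/j!`). -/
-- adapted from `R2OneModeTwoConditions.rhoLim_eq_mul_phi` (Theorems/ImplosionDichotomyDenseExcursionR2AdmissibleData.lean)
theorem rhoLim_eq_mul_phi (P : DensityProfile) (σ : ℝ) (x : T3) :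
    rhoLim P σ x = ratioLimit P σ * P.β x *
      ∑' j : ℕ, bE j / (j.factorial : ℝ) * (σ ^ 3 * (ratioLimit P σ * P.β x)) ^ j := by
  rw [rhoLim, ← tsum_mul_left]
  refine tsum_congr fun j => ?_
  rw [clusterCoeff, mul_pow, mul_pow]
  ring

/-- The exponential rate `K e^{-(N+1)/K}` tends to `0` in `ℝ≥0∞`. -/
theorem tendsto_ofReal_Kexp (K : ℝ) (hK : 0 < K) :
    Tendsto (fun N : ℕ => ENNReal.ofReal (K * Real.exp (-(K⁻¹ * ((N : ℝ) + 1))))) atTop (𝓝 0) := by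
  have h1 : Tendsto (fun N : ℕ => K⁻¹ * ((N : ℝ) + 1)) atTop atTop :=
    (tendsto_natCast_atTop_atTop.atTop_add tendsto_const_nhds).const_mul_atTop (inv_pos.2 hK)
  have h2 : Tendsto (fun N : ℕ => K * Real.exp (-(K⁻¹ * ((N : ℝ) + 1)))) atTop (𝓝 (K * 0)) :=
    (Real.tendsto_exp_neg_atTop_nhds_zero.comp h1).const_mul K
  rw [mul_zero] at h2
  have h3 := ENNReal.tendsto_ofReal h2
  rwa [ENNReal.ofReal_zero] at h3

/-- **The profile part.** For `B ≥ 1`, `0 < σ < 1/2` with `e · 2B² v₁ σ³ ≤ 1/32`, and continuous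
profiles within `[B⁻¹, B]`: with `P = profileOf a` (`SmallDensity P σ` since `P.M ≤ B²`) and the
chemical potential `μ = log (ratioLimit P σ / ∫a)` one has `e^μ a = ratioLimit · β ∈ [0, 2B²]`,
`(e^μ a) Φ(σ³ e^μ a) = rhoLim P σ` pointwise (so unit mass), the local Gibbs laws are probability
measures, and the three empirical fields at time `0` converge in probability to `(rhoLim P σ, u₀, θ₀)`
through every flow family (exponential field bounds of `UniformLGC`, `Φ_0 = id` a.e.). -/
theorem statics_of_bounds (hB : 1 ≤ B) (hσ : 0 < σ) (hσ2 : σ < 1 / 2)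
    (hsm : Real.exp 1 * (2 * B ^ 2 * v₁ * σ ^ 3) ≤ 1 / 32)
    (Φ : ℝ → ℝ) (hΦeq : ∀ u, Φ u = ∑' j : ℕ, bE j / (j.factorial : ℝ) * u ^ j)
    (ha : Continuous a) (hθ : Continuous θ₀) (hu : Continuous u₀)
    (hbd : ∀ x, B⁻¹ ≤ a x ∧ a x ≤ B ∧ B⁻¹ ≤ θ₀ x ∧ θ₀ x ≤ B ∧ ‖u₀ x‖ ≤ B) :
    ∃ μ : ℝ, (∫ x, Real.exp μ * a x * Φ (σ ^ 3 * (Real.exp μ * a x)) = 1) ∧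
      (∀ x, Real.exp μ * a x ∈ Icc (0 : ℝ) (4 * B ^ 2)) ∧
      ∀ Ψ : (N : ℕ) → HardSphereFlow (Torus.geometry (Fin 3)) (hsDiameter σ N) (N + 1),
        (∀ N, IsProbabilityMeasure (localGibbsLaw σ a u₀ θ₀ N (Ψ N))) ∧
        TendstoHydroFieldsAt (fun N => localGibbsLaw σ a u₀ θ₀ N (Ψ N)) Ψ
          (fun _ x => Real.exp μ * a x * Φ (σ ^ 3 * (Real.exp μ * a x))) (fun _ => u₀) (fun _ => θ₀) 0 := by
  have hB0 : 0 < B := by linarith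
  have hBinv : 0 < B⁻¹ := inv_pos.2 hB0
  have ha0 : ∀ x, 0 < a x := fun x => hBinv.trans_le (hbd x).1
  have hθ0 : ∀ x, 0 < θ₀ x := fun x => hBinv.trans_le (hbd x).2.2.1
  set P := profileOf a ha ha0 with hP
  obtain ⟨hβB, hPM⟩ := profileOf_β_le hB ha ha0 fun x => ⟨(hbd x).1, (hbd x).2.1⟩
  have hsmall : Real.exp 1 * (2 * (profileOf a ha ha0).M * v₁ * σ ^ 3) ≤ 1 / 32 := by
    refine le_trans ?_ hsm
    have he : 0 < Real.exp 1 := Real.exp_pos 1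
    have hv : 0 < v₁ := v₁_pos
    have h3 : 0 < σ ^ 3 := pow_pos hσ 3
    have : (profileOf a ha ha0).M * (v₁ * σ ^ 3) ≤ B ^ 2 * (v₁ * σ ^ 3) :=
      mul_le_mul_of_nonneg_right hPM (by positivity)
    nlinarith
  have hPs : SmallDensity P σ :=
    UniformLGC.smallDensity_of_eta_le (Mstar := 2 * P.M) hσ hσ2 (by linarith [P.M_pos]) hsmall
  have hRmem := hPs.ratioLimit_mem
  have hR0 := hPs.ratioLimit_pos
  have hI : 0 < ∫ y, a y := integral_pos_of_continuous_pos ha ha0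
  set μ : ℝ := Real.log (ratioLimit P σ / ∫ y, a y) with hμ
  have hexp : Real.exp μ = ratioLimit P σ / ∫ y, a y := Real.exp_log (div_pos hR0 hI)
  have hkey : ∀ x, Real.exp μ * a x = ratioLimit P σ * P.β x := fun x => by
    rw [hexp, hP, profileOf_β, div_mul_eq_mul_div, mul_div_assoc]
  have hρpt : ∀ x, Real.exp μ * a x * Φ (σ ^ 3 * (Real.exp μ * a x)) = rhoLim P σ x := fun x => by
    rw [hkey, rhoLim_eq_mul_phi P σ x, hΦeq]
  have hρfun : (fun (_ : ℝ) (x : T3) => Real.exp μ * a x * Φ (σ ^ 3 * (Real.exp μ * a x))) =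
      fun _ => rhoLim P σ := by
    funext t x
    exact hρpt x
  refine ⟨μ, ?_, fun x => ?_, fun Ψ =>
    ⟨fun N => isProbabilityMeasure_localGibbsLaw ha hθ hu ha0 hθ0 hσ2.le N (Ψ N), ?_⟩⟩
  · rw [integral_congr_ae (ae_of_all _ hρpt)]
    exact PolynomialCompressionStatics.integral_rhoLim_eq_one hPs
  · rw [hkey]
    refine ⟨mul_nonneg hR0.le (P.pos x).le, ?_⟩
    calc ratioLimit P σ * P.β x ≤ 2 * B ^ 2 := mul_le_mul hRmem.2 (hβB x) (P.pos x).le (by norm_num)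
      _ ≤ 4 * B ^ 2 := by nlinarith
  · rw [hρfun]
    intro χ hχ δ hδ
    refine ⟨?_, ?_, ?_⟩
    · obtain ⟨K, hK, hKb⟩ := UniformLGC.localGibbsMeasure_density_le (u₀ := u₀) ha hθ hu ha0 hθ0
        hσ hσ2 hsmall hχ hδ
      refine tendsto_of_tendsto_of_tendsto_of_le_of_le tendsto_const_nhds (tendsto_ofReal_Kexp K hK)
        (fun _ => zero_le) (fun N => ?_)
      refine le_trans (le_of_eq ?_) (hKb N)
      rw [← localGibbsLaw_preimage_flow_zero σ a u₀ θ₀ N (Ψ N)]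
      congr 1
      ext z
      simp only [Set.mem_preimage, Set.mem_setOf_eq, empiricalDensityField_eq_sum]
      exact Iff.rfl
    · obtain ⟨K, hK, hKb⟩ := UniformLGC.localGibbsMeasure_momentum_le ha hθ hu ha0 hθ0
        hσ hσ2 hsmall hχ hδ
      refine tendsto_of_tendsto_of_tendsto_of_le_of_le tendsto_const_nhds (tendsto_ofReal_Kexp K hK)
        (fun _ => zero_le) (fun N => ?_)
      refine le_trans (le_of_eq ?_) (hKb N)
      rw [← localGibbsLaw_preimage_flow_zero σ a u₀ θ₀ N (Ψ N)]
      rfl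
    · obtain ⟨K, hK, hKb⟩ := UniformLGC.localGibbsMeasure_energy_le ha hθ hu ha0 hθ0
        hσ hσ2 hsmall hχ hδ
      refine tendsto_of_tendsto_of_tendsto_of_le_of_le tendsto_const_nhds (tendsto_ofReal_Kexp K hK)
        (fun _ => zero_le) (fun N => ?_)
      refine le_trans (le_of_eq ?_) (hKb N)
      rw [← localGibbsLaw_preimage_flow_zero σ a u₀ θ₀ N (Ψ N)]
      rfl

end Profiles

end VitaliLocalGibbsStatics

/-! ### §4 The item -/

open VitaliLocalGibbsStatics in
/-- **Low-density statics of the canonical local Gibbs laws** (`VitaliAmplitudeTransfer.LocalGibbsStatics`,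
stmt-AtomisticToContinuum-11874). For `B ≥ 1` take
`σ₀ = min (1/2) (min (1/(64 e v₁ B²)) (ρ₀/(8B² + 1)))` (`ρ₀` the radius of `eos_package`): for
`0 < σ < σ₀` the local equation of state `R z = z Φ(σ³ z)` and its inverse `Rinv y = y Rf(σ³ y)` are
real-analytic on `[0, 4B²]`, `R` strictly increasing, `R 0 = 0`, mutually inverse with the two-sided
bounds `z/2 ≤ R z ≤ 2z`, `y/2 ≤ Rinv y ≤ 2y` on `[0, 4B²]` resp. `[0, 2B]` (`eos_clauses`); and for
continuous profiles within `[B⁻¹, B]` the chemical potential `μ = log (ratioLimit/∫a)` gives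
`∫ R(e^μ a) = 1`, `e^μ a ∈ [0, 4B²]`, probability local Gibbs laws, and the law of large numbers at
`t = 0` with the identified density `R(e^μ a(x)) = rhoLim (profileOf a) σ x` (`statics_of_bounds`). -/
theorem localGibbsStatics_proof :
    Summit.AtomisticToContinuum.HydrodynamicLimit.Theses.VitaliAmplitudeTransfer.LocalGibbsStatics := by
  unfold Summit.AtomisticToContinuum.HydrodynamicLimit.Theses.VitaliAmplitudeTransfer.LocalGibbsStatics
  intro B hB
  obtain ⟨ρ₀, hρ₀, Φ, Rf, hΦeq, hΦan, hψ, hRfan, hsol, hbd, huniq⟩ := eos_package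
  have he : 0 < Real.exp 1 := Real.exp_pos 1
  have hv : 0 < v₁ := v₁_pos
  have hB0 : 0 < B := by linarith
  have hB2 : 1 ≤ B ^ 2 := one_le_pow₀ hB
  set c₁ : ℝ := 1 / (64 * Real.exp 1 * v₁ * B ^ 2) with hc₁
  set c₂ : ℝ := ρ₀ / (8 * B ^ 2 + 1) with hc₂
  have hc₁0 : 0 < c₁ := by positivity
  have hc₂0 : 0 < c₂ := by positivity
  refine ⟨min (1 / 2) (min c₁ c₂), lt_min (by norm_num) (lt_min hc₁0 hc₂0), fun σ hσ hσlt => ?_⟩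
  have hσ2 : σ < 1 / 2 := hσlt.trans_le (min_le_left _ _)
  have hσc₁ : σ < c₁ := hσlt.trans_le ((min_le_right _ _).trans (min_le_left _ _))
  have hσc₂ : σ < c₂ := hσlt.trans_le ((min_le_right _ _).trans (min_le_right _ _))
  have hσ3 : σ ^ 3 ≤ σ := pow_le_of_le_one hσ.le (by linarith) (by norm_num)
  -- the uniform smallness of the cluster expansion
  have hsm : Real.exp 1 * (2 * B ^ 2 * v₁ * σ ^ 3) ≤ 1 / 32 := by
    have h1 : Real.exp 1 * (2 * B ^ 2 * v₁ * σ ^ 3) ≤ Real.exp 1 * (2 * B ^ 2 * v₁ * c₁) := by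
      have : σ ^ 3 ≤ c₁ := hσ3.trans hσc₁.le
      gcongr
    have h2 : Real.exp 1 * (2 * B ^ 2 * v₁ * c₁) = 1 / 32 := by
      rw [hc₁]
      field_simp
      norm_num
    linarith
  -- every argument of the equation of state stays in the ball of radius `ρ₀`
  have hpack : σ ^ 3 * (8 * B ^ 2) < ρ₀ := by
    have h1 : σ ^ 3 * (8 * B ^ 2) ≤ σ * (8 * B ^ 2) := mul_le_mul_of_nonneg_right hσ3 (by positivity)
    have h2 : σ * (8 * B ^ 2) < c₂ * (8 * B ^ 2) := mul_lt_mul_of_pos_right hσc₂ (by positivity)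
    have h3 : c₂ * (8 * B ^ 2) < ρ₀ := by
      rw [hc₂, div_mul_eq_mul_div, div_lt_iff₀ (by positivity)]
      nlinarith
    linarith
  obtain ⟨h1, h2, h3, h4, h5, h6⟩ := eos_clauses hB hσ hpack hΦan hψ hRfan hsol hbd huniq
  refine ⟨fun z => z * Φ (σ ^ 3 * z), fun y => y * Rf (σ ^ 3 * y), h1, h2, h3, h4, h5, h6, ?_⟩
  intro a θ₀ u₀ ha hθ hu hbounds
  exact statics_of_bounds hB hσ hσ2 hsm Φ hΦeq ha hθ hu hbounds

end Summit.AtomisticToContinuum.HydrodynamicLimit.Theorems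

end
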